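import Mathlib
import Literature.NumberTheory.LFunctions.SuzukiWeilHilbertSpaceDefs
import Literature.NumberTheory.LFunctions.WeilZeroSum
import Literature.NumberTheory.LFunctions.ZetaZeroReciprocalSum
import Literature.NumberTheory.LFunctions.SuzukiWeilHilbertSpace
import Literature.NumberTheory.LFunctions.SuzukiWeilOrthogonalSetProofs
import Literature.NumberTheory.LFunctions.SuzukiWeilKernelExpansionProofs
import HarnessLib

/-!
# Suzuki 2025 Prop. 5.8 (RH ⟺ norm identity ∧ zero separation on `V(0)`): the RH-free door and `Suzuki2025_prop58` HOLDS (re-homed proofs)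

**Suzuki 2025 Prop. 5.8 — the named fact `Literature.NumberTheory.LFunctions.Suzuki2025_prop58` (`SuzukiWeilHilbertSpace.lean`)
HOLDS**: `RiemannHypothesis ↔ (WeilNormIdentityOn (suzukiV 0) ∧ ZeroSeparationOn (suzukiV 0))` — M. Suzuki, *On the Hilbert space
derived from the Weil distribution*, Canad. J. Math. (2025) = arXiv:2301.00421, Prop. 5.8 p. 17 (= arXiv v1 Thm. 1.3 p. 3): «Let
`V(0) = L²(0,∞) ∩ 𝖪L²(0,∞)` be as in (5.2). Then the RH is true if and only if the following two conditions hold: (1)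
`‖ψ‖²_{L²(ℝ)} = 2⁻¹⟨ψ,ψ⟩_W` for every `ψ ∈ V(0)`. (2) For a given `γ ∈ Γ` and any `ε > 0`, there exists `ψ ∈ V(0)` such that
`ψ̂(−γ) = 1`, `|ψ̂(−γ′)| ≤ ε/|γ − γ′|^{1+δ}` for every `γ′ ∈ Γ∖{γ}` for some `δ > 0` independent of `γ`, `ε`, and `ψ`.»
An RH-EQUIVALENCE PROVED AS AN EQUIVALENCE (kernel both ways): ⟹ = CJM Thm. 5.5 (1) (the tree theorem
`Suzuki2025_thm55_normIdentity_holds`, `SuzukiWeilKernelExpansionProofs.lean`) and the orthogonal family `ψ_γ`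
(`zeroSeparationOn_suzukiV_zero_of_riemannHypothesis`, `SuzukiWeilOrthogonalSetProofs.lean`); ⟸ = the RH-FREE door (printed
sufficiency proof, §3.4: a Weil-sign argument at a non-real zero off the line), until now proved only on the Summits side of the
tree (`Summits/RiemannHypothesis/RiemannHypothesis/Theorems/DeBrangesChain{Separation,Door,Converse}.lean`, where the fact was
discharged as `Summit.RiemannHypothesis.RiemannHypothesis.Theorems.DeBrangesChain.Suzuki2025_prop58_holds` because a Literature
module cannot import the door).  RE-HOMED into `Literature/` by the Hodge foundations lane (`lit-hodgefound`, seat p20,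
generation 38): verbatim DECLARATION-LEVEL ports of the theorem-only modules `…/DeBrangesChainSeparation.lean` (11 declarations:
the separation weight `sepWeight` — an honest `ℝ`-valued definition with body — and D1/D2), `…/DeBrangesChainDoor.lean` (2) and
`…/DeBrangesChainConverse.lean` (1 of 16: `suzuki2025_prop58_of_normIdentity`), namespace
`Summit.RiemannHypothesis.RiemannHypothesis.Theorems.DeBrangesChain` re-rooted as `Literature.NumberTheory.LFunctions.SuzukiWeilCriterion`,
the Summits conjecture-leaf abbreviations `IsolatedV0` / `ChainDoorV0` (`…/DeBrangesChainDefs.lean`) UNFOLDED (not re-declared), followed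
by the EXACT-name discharge `Literature.NumberTheory.LFunctions.Suzuki2025_prop58_holds : Suzuki2025_prop58`.  Built on the tree's
Literature layer only (`SuzukiWeilHilbertSpaceDefs`, `SuzukiWeilHilbertSpace`, `SuzukiWeilOrthogonalSetProofs`,
`SuzukiWeilKernelExpansionProofs`, `WeilZeroSum`, `ZetaZeroReciprocalSum`) and Mathlib (`RiemannHypothesis`,
`riemannZeta`); no new named fact (D-0026), no Summits import, every declaration carries the citation of the printed statement it
formalises or serves.  The Summits originals stay in place (transitional duplication).  WHAT THIS IS NOT: not evidence for either
side of RH — an RH-equivalence becoming a tree theorem in both directions re-indexes RH through Suzuki's criterion and moves RH by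
nothing; HC / anything Hodge-side is untouched.
-/

noncomputable section

/-!
## Part 1 — port of `Summits/RiemannHypothesis/RiemannHypothesis/Theorems/DeBrangesChainSeparation.lean` (11 declarations kept)

# The two RH-FREE analytic inputs of the sufficiency proof of Suzuki's criterion (CJM Prop. 5.8 ⟸)

Pure analysis about the non-trivial zeros of `ζ` as a weighted discrete set (no statement about the Riemann hypothesis is
asserted or used), factored as named lemmas exactly as the printed sufficiency proof of M. Suzuki, *On the Hilbert space
derived from the Weil distribution*, Canad. J. Math. (2025) = arXiv:2301.00421, Prop. 5.8 (= arXiv v1 Thm. 1.3; §3.4, p. 7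
L129–149) uses them:
* D1 (summability, EXPONENT 2 FROM THE TREE) — `summable_order_mul_sepWeight_sq`: for every `δ ≥ 0` and every `γ₀`,
  `Σ_ρ m(ρ)·B(γ_ρ)² < ∞` over the non-trivial zeros (`γ_ρ = i(ρ − ½)`, `suzukiZeroParam`), where
  `B(z) = |γ₀ − z|^{−1−δ} + |γ̄₀ − z|^{−1−δ}` (`sepWeight`) is the separation weight of the printed condition (2).  From
  `ZetaZeroSum.summable_zeroOrder_div_one_add_sq` (`Σ m(ρ)/(1+(Im ρ)²) < ∞`, Jensen) and
  `riemannZetaNontrivialZeros_finite_inter_ball`; the printed "since `Σ_γ |γ|^{−1−δ} < ∞`" (exponent `1+δ`) is NOT needed,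
  because each tail term of the Weil sum is a product of two `εB`-bounded values, of size `ε²B² = O(|γ|^{−2−2δ})`.
* D2 (NEGATIVITY UNDER SEPARATION) — `weilSum_re_neg_of_separation`: for a non-trivial zero `ρ₀` OFF the critical line and
  `δ > 0` there is `ε > 0` such that for all value assignments `c₁, c₂ : ℂ → ℂ` with `c₁(γ₀) = 1`, `c₂(γ̄₀) = 1`,
  `|c₁(γ_ρ)| ≤ ε|γ₀ − γ_ρ|^{−1−δ}` (`ρ ≠ ρ₀`), `|c₂(γ_ρ)| ≤ ε|γ̄₀ − γ_ρ|^{−1−δ}` (`ρ ≠ 1 − ρ̄₀`), every unconditional sum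
  `S` of `ρ ↦ m(ρ)·(c₁ − c₂)(γ_ρ)·conj (c₁ − c₂)(γ̄_ρ)` has `Re S < 0`: the two main terms (at `ρ₀` and `1 − ρ̄₀`) have
  real part `≤ −¼` each once `ε ≤ |γ₀ − γ̄₀|^{1+δ}/4`, the tail is `≤ ε² Σ m B² ≤ ¼` once `ε ≤ 1/(4(ΣmB² + 1))` — honest
  constants for the printed "`⟨ψ,ψ⟩_W = −m_{γ₀} + O(ε)`".
WHAT THIS IS NOT: nothing here bears on the truth of RH.  Reference: [Suzuki2025WeilHilbertSpace, CJM Prop. 5.8 p. 17,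
proof; arXiv v1 §3.4 p. 7].
-/

section Part1

namespace Literature.NumberTheory.LFunctions.SuzukiWeilCriterion

open Literature.NumberTheory.LFunctions _root_.MeasureTheory _root_.Complex _root_.Filter _root_.Set
open scoped ComplexConjugate _root_.Topology

/-- The reflected zero `1 − ρ̄₀` differs from `ρ₀` when `ρ₀` is off the critical line. [cite: Suzuki2025WeilHilbertSpace, CJM Prop. 5.8 p. 17, proof of sufficiency (= arXiv v1 Thm. 1.3, §3.4 p. 7 L129–149): the separation weight and the sign of the Weil sum] -/
theorem one_sub_conj_ne_self {ρ₀ : ℂ} (hoff : ρ₀.re ≠ 1 / 2) : 1 - conj ρ₀ ≠ ρ₀ := by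
  intro h
  have := congrArg Complex.re h
  simp only [sub_re, one_re, conj_re] at this
  apply hoff
  linarith

/-! ## D2 — the separation weight and its summability against the zeros (exponent 2 suffices) -/

/-- The separation weight `B(z) = |γ₀ − z|^{−1−δ} + |γ̄₀ − z|^{−1−δ}` of the printed proof
(Lean junk `1/0 = 0` at `z = γ₀, γ̄₀`, never used there).
[cite: Suzuki2025WeilHilbertSpace, CJM Prop. 5.8 p. 17, proof of sufficiency (= arXiv v1 Thm. 1.3, §3.4 p. 7 L129–149): the separation weight and the sign of the Weil sum] -/
def sepWeight (γ₀ : ℂ) (δ : ℝ) (z : ℂ) : ℝ :=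
  1 / ‖γ₀ - z‖ ^ (1 + δ) + 1 / ‖conj γ₀ - z‖ ^ (1 + δ)

/-- `B ≥ 0`.
[cite: Suzuki2025WeilHilbertSpace, CJM Prop. 5.8 p. 17, proof of sufficiency (= arXiv v1 Thm. 1.3, §3.4 p. 7 L129–149): the separation weight and the sign of the Weil sum] -/
theorem sepWeight_nonneg (γ₀ : ℂ) (δ : ℝ) (z : ℂ) : 0 ≤ sepWeight γ₀ δ z := by
  unfold sepWeight
  have h1 : 0 ≤ ‖γ₀ - z‖ ^ (1 + δ) := Real.rpow_nonneg (norm_nonneg _) _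
  have h2 : 0 ≤ ‖conj γ₀ - z‖ ^ (1 + δ) := Real.rpow_nonneg (norm_nonneg _) _
  positivity

/-- `B(z̄) = B(z)` (the two terms swap).
[cite: Suzuki2025WeilHilbertSpace, CJM Prop. 5.8 p. 17, proof of sufficiency (= arXiv v1 Thm. 1.3, §3.4 p. 7 L129–149): the separation weight and the sign of the Weil sum] -/
theorem sepWeight_conj (γ₀ : ℂ) (δ : ℝ) (z : ℂ) : sepWeight γ₀ δ (conj z) = sepWeight γ₀ δ z := by
  unfold sepWeight
  have h1 : ‖γ₀ - conj z‖ = ‖conj γ₀ - z‖ := by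
    rw [← Complex.norm_conj (γ₀ - conj z), map_sub, Complex.conj_conj]
  have h2 : ‖conj γ₀ - conj z‖ = ‖γ₀ - z‖ := by
    rw [← map_sub, Complex.norm_conj]
  rw [h1, h2, add_comm]

/-- One reciprocal power: for `|w| ≥ 1`, `1/|w|^{1+δ} ≤ 1/|w|` (`δ ≥ 0`).
[cite: Suzuki2025WeilHilbertSpace, CJM Prop. 5.8 p. 17, proof of sufficiency (= arXiv v1 Thm. 1.3, §3.4 p. 7 L129–149): the separation weight and the sign of the Weil sum] -/
theorem one_div_rpow_le_one_div {x δ : ℝ} (hx : 1 ≤ x) (hδ : 0 ≤ δ) :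
    1 / x ^ (1 + δ) ≤ 1 / x := by
  have hx0 : 0 < x := by linarith
  have h : x ≤ x ^ (1 + δ) := by
    calc x = x ^ (1 : ℝ) := (Real.rpow_one x).symm
      _ ≤ x ^ (1 + δ) := Real.rpow_le_rpow_of_exponent_le hx (by linarith)
  exact one_div_le_one_div_of_le hx0 h

/-- Tail bound: for `|z| ≥ 2|γ₀| + 2`, `B(z) ≤ 4/(|z| + 2)`.
[cite: Suzuki2025WeilHilbertSpace, CJM Prop. 5.8 p. 17, proof of sufficiency (= arXiv v1 Thm. 1.3, §3.4 p. 7 L129–149): the separation weight and the sign of the Weil sum] -/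
theorem sepWeight_le_of_far {γ₀ : ℂ} {δ : ℝ} (hδ : 0 ≤ δ) {z : ℂ} (hz : 2 * ‖γ₀‖ + 2 ≤ ‖z‖) :
    sepWeight γ₀ δ z ≤ 4 / (‖z‖ + 2) := by
  have hpos : 0 < ‖z‖ / 2 + 1 := by positivity
  have key : ∀ w : ℂ, ‖w‖ = ‖γ₀‖ → 1 / ‖w - z‖ ^ (1 + δ) ≤ 2 / (‖z‖ + 2) := by
    intro w hw
    have hge : ‖z‖ / 2 + 1 ≤ ‖w - z‖ := by
      have := norm_sub_norm_le z w
      rw [norm_sub_rev] at this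
      linarith
    have h1 : 1 ≤ ‖w - z‖ := le_trans (by linarith [norm_nonneg z]) hge
    have hrw : ‖z‖ / 2 + 1 = (‖z‖ + 2) / 2 := by ring
    calc 1 / ‖w - z‖ ^ (1 + δ) ≤ 1 / ‖w - z‖ := one_div_rpow_le_one_div h1 hδ
      _ ≤ 1 / (‖z‖ / 2 + 1) := one_div_le_one_div_of_le hpos hge
      _ = 2 / (‖z‖ + 2) := by rw [hrw, one_div_div]
  unfold sepWeight
  have hA := key γ₀ rfl
  have hB := key (conj γ₀) (Complex.norm_conj γ₀)
  calc 1 / ‖γ₀ - z‖ ^ (1 + δ) + 1 / ‖conj γ₀ - z‖ ^ (1 + δ)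
      ≤ 2 / (‖z‖ + 2) + 2 / (‖z‖ + 2) := add_le_add hA hB
    _ = 4 / (‖z‖ + 2) := by ring

/-- `|γ(ρ)| ≥ |Im ρ|` (indeed `Re γ(ρ) = −Im ρ`).
[cite: Suzuki2025WeilHilbertSpace, CJM Prop. 5.8 p. 17, proof of sufficiency (= arXiv v1 Thm. 1.3, §3.4 p. 7 L129–149): the separation weight and the sign of the Weil sum] -/
theorem abs_im_le_norm_suzukiZeroParam (ρ : ℂ) : |ρ.im| ≤ ‖suzukiZeroParam ρ‖ := by
  have h : (suzukiZeroParam ρ).re = -ρ.im := by simp [suzukiZeroParam]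
  have := Complex.abs_re_le_norm (suzukiZeroParam ρ)
  rw [h, abs_neg] at this
  exact this

/-- Far from `γ₀`, `m B(γ_ρ)² ≤ 16 · m/(1 + (Im ρ)²)`.
[cite: Suzuki2025WeilHilbertSpace, CJM Prop. 5.8 p. 17, proof of sufficiency (= arXiv v1 Thm. 1.3, §3.4 p. 7 L129–149): the separation weight and the sign of the Weil sum] -/
theorem order_mul_sepWeight_sq_le {γ₀ : ℂ} {δ : ℝ} (hδ : 0 ≤ δ) {ρ : ℂ}
    (hρ : ρ ∈ ZetaZeros.riemannZetaNontrivialZeros) (hfar : 2 * ‖γ₀‖ + 2 ≤ ‖suzukiZeroParam ρ‖) :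
    (riemannZetaZeroOrder ρ : ℝ) * sepWeight γ₀ δ (suzukiZeroParam ρ) ^ 2 ≤
      16 * ((riemannZetaZeroOrder ρ : ℝ) / (1 + ρ.im ^ 2)) := by
  have hm : (0 : ℝ) ≤ riemannZetaZeroOrder ρ := by
    have h1 := ZetaZeros.riemannZetaNontrivialZeros.one_le_order hρ
    exact_mod_cast (show (0 : ℤ) ≤ riemannZetaZeroOrder ρ by omega)
  have hB := sepWeight_le_of_far hδ hfar
  have hB0 := sepWeight_nonneg γ₀ δ (suzukiZeroParam ρ)
  set r := ‖suzukiZeroParam ρ‖ with hr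
  have hr0 : 0 ≤ r := norm_nonneg _
  have him : ρ.im ^ 2 ≤ r ^ 2 := by
    have := abs_im_le_norm_suzukiZeroParam ρ
    rw [← hr] at this
    nlinarith [abs_nonneg ρ.im, sq_abs ρ.im]
  have hsq : sepWeight γ₀ δ (suzukiZeroParam ρ) ^ 2 ≤ (4 / (r + 2)) ^ 2 :=
    pow_le_pow_left₀ hB0 hB 2
  have hfrac : (4 / (r + 2)) ^ 2 ≤ 16 / (1 + ρ.im ^ 2) := by
    rw [div_pow, show (4 : ℝ) ^ 2 = 16 by norm_num]
    apply div_le_div_of_nonneg_left (by norm_num) (by positivity)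
    nlinarith
  calc (riemannZetaZeroOrder ρ : ℝ) * sepWeight γ₀ δ (suzukiZeroParam ρ) ^ 2
      ≤ (riemannZetaZeroOrder ρ : ℝ) * (16 / (1 + ρ.im ^ 2)) :=
        mul_le_mul_of_nonneg_left (hsq.trans hfrac) hm
    _ = 16 * ((riemannZetaZeroOrder ρ : ℝ) / (1 + ρ.im ^ 2)) := by ring

/-- **D1 (from the tree, exponent 2): `Σ_ρ m(ρ) B(γ_ρ)² < ∞`** over the non-trivial zeros — finitely
many zeros with `|γ_ρ| < 2|γ₀| + 2` (`riemannZetaNontrivialZeros_finite_inter_ball`) and the tail is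
dominated by `16 Σ m(ρ)/(1 + (Im ρ)²)` (`ZetaZeroSum.summable_zeroOrder_div_one_add_sq`).
[cite: Suzuki2025WeilHilbertSpace, CJM Prop. 5.8 p. 17, proof of sufficiency (= arXiv v1 Thm. 1.3, §3.4 p. 7 L129–149): the separation weight and the sign of the Weil sum] -/
theorem summable_order_mul_sepWeight_sq (γ₀ : ℂ) {δ : ℝ} (hδ : 0 ≤ δ) :
    Summable (fun ρ : ZetaZeros.riemannZetaNontrivialZeros ↦
      (riemannZetaZeroOrder (ρ : ℂ) : ℝ) * sepWeight γ₀ δ (suzukiZeroParam ρ) ^ 2) := by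
  set R : ℝ := 2 * ‖γ₀‖ + 2 with hR
  -- the near zeros form a finite set
  set near : Set ZetaZeros.riemannZetaNontrivialZeros := {ρ | ‖suzukiZeroParam (ρ : ℂ)‖ < R}
    with hnear
  have hfin : near.Finite := by
    have hball := riemannZetaNontrivialZeros_finite_inter_ball (1 / 2) R
    have hsub : near ⊆ Subtype.val ⁻¹' (ZetaZeros.riemannZetaNontrivialZeros ∩ Metric.ball (1 / 2) R) := by
      intro ρ hρ
      refine ⟨ρ.2, ?_⟩
      rw [Metric.mem_ball, dist_eq_norm]
      have : ‖suzukiZeroParam (ρ : ℂ)‖ = ‖(ρ : ℂ) - 1 / 2‖ := by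
        simp [suzukiZeroParam, Complex.norm_I]
      rw [← this]
      exact hρ
    exact (hball.preimage Subtype.val_injective.injOn).subset hsub
  refine (hfin.summable_compl_iff).1 ?_
  -- on the complement compare with `16 m/(1+γ²)`
  have hg : Summable (fun ρ : ZetaZeros.riemannZetaNontrivialZeros ↦
      16 * ((riemannZetaZeroOrder (ρ : ℂ) : ℝ) / (1 + (ρ : ℂ).im ^ 2))) :=
    (ZetaZeroSum.summable_zeroOrder_div_one_add_sq).mul_left 16
  refine Summable.of_nonneg_of_le (fun ρ ↦ ?_) (fun ρ ↦ ?_) (hg.subtype _)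
  · have hm : (0 : ℝ) ≤ riemannZetaZeroOrder ((ρ : ZetaZeros.riemannZetaNontrivialZeros) : ℂ) := by
      have h1 := ZetaZeros.riemannZetaNontrivialZeros.one_le_order
        (ρ : ZetaZeros.riemannZetaNontrivialZeros).2
      exact_mod_cast (show (0 : ℤ) ≤ _ by omega)
    exact mul_nonneg hm (sq_nonneg _)
  · have hfar : R ≤ ‖suzukiZeroParam ((ρ : ZetaZeros.riemannZetaNontrivialZeros) : ℂ)‖ :=
      not_lt.1 ρ.2
    exact order_mul_sepWeight_sq_le hδ (ρ : ZetaZeros.riemannZetaNontrivialZeros).2 hfar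

/-- Real-part bookkeeping of the two main terms: if `|a|, |b| ≤ 1/4` then
`Re((1 − a)(b̄ − 1)) ≤ −1/4`.
[cite: Suzuki2025WeilHilbertSpace, CJM Prop. 5.8 p. 17, proof of sufficiency (= arXiv v1 Thm. 1.3, §3.4 p. 7 L129–149): the separation weight and the sign of the Weil sum] -/
theorem re_main_term_le {a b : ℂ} (ha : ‖a‖ ≤ 1 / 4) (hb : ‖b‖ ≤ 1 / 4) :
    ((1 - a) * (conj b - 1)).re ≤ -(1 / 4) := by
  have hexp : (1 - a) * (conj b - 1) = -1 + (a + conj b - a * conj b) := by ring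
  rw [hexp, add_re, neg_re, one_re]
  have h1 : (a + conj b - a * conj b).re ≤ ‖a + conj b - a * conj b‖ := Complex.re_le_norm _
  have h2 : ‖a + conj b - a * conj b‖ ≤ ‖a‖ + ‖b‖ + ‖a‖ * ‖b‖ := by
    calc ‖a + conj b - a * conj b‖ ≤ ‖a + conj b‖ + ‖a * conj b‖ := norm_sub_le _ _
      _ ≤ (‖a‖ + ‖conj b‖) + ‖a‖ * ‖conj b‖ := add_le_add (norm_add_le _ _) (norm_mul_le _ _)
      _ = ‖a‖ + ‖b‖ + ‖a‖ * ‖b‖ := by rw [Complex.norm_conj]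
  nlinarith [norm_nonneg a, norm_nonneg b]

/-- **D2 — NEGATIVITY UNDER SEPARATION (the RH-free analysis lemma of [Su25c] §3.4).** Let `ρ₀` be a
non-trivial zero OFF the critical line, `γ₀ = γ(ρ₀)` (so `γ̄₀ = γ(1 − ρ̄₀) ≠ γ₀`), and `δ > 0`.
There is `ε > 0` such that for all value assignments `c₁, c₂ : ℂ → ℂ` with `c₁(γ₀) = 1`,
`c₂(γ̄₀) = 1`, `|c₁(γ_ρ)| ≤ ε|γ₀ − γ_ρ|^{−1−δ}` (`ρ ≠ ρ₀`) and `|c₂(γ_ρ)| ≤ ε|γ̄₀ − γ_ρ|^{−1−δ}`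
(`ρ ≠ 1 − ρ̄₀`), every value `S` of the Weil sum `Σ_ρ m(ρ) c(γ_ρ) conj c(γ̄_ρ)` of `c = c₁ − c₂`
has `Re S < 0` (the two main terms have real part `≤ −1/4` each, the rest is `O(ε²)` by D1).
[cite: Suzuki2025WeilHilbertSpace, CJM Prop. 5.8 p. 17, proof of sufficiency (= arXiv v1 Thm. 1.3, §3.4 p. 7 L129–149): the separation weight and the sign of the Weil sum] -/
theorem weilSum_re_neg_of_separation {ρ₀ : ℂ} (hρ₀ : ρ₀ ∈ ZetaZeros.riemannZetaNontrivialZeros)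
    (hoff : ρ₀.re ≠ 1 / 2) {δ : ℝ} (hδ : 0 < δ) :
    ∃ ε : ℝ, 0 < ε ∧ ∀ c₁ c₂ : ℂ → ℂ,
      c₁ (suzukiZeroParam ρ₀) = 1 →
      c₂ (conj (suzukiZeroParam ρ₀)) = 1 →
      (∀ ρ ∈ ZetaZeros.riemannZetaNontrivialZeros, ρ ≠ ρ₀ →
        ‖c₁ (suzukiZeroParam ρ)‖ ≤ ε / ‖suzukiZeroParam ρ₀ - suzukiZeroParam ρ‖ ^ (1 + δ)) →
      (∀ ρ ∈ ZetaZeros.riemannZetaNontrivialZeros, ρ ≠ 1 - conj ρ₀ →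
        ‖c₂ (suzukiZeroParam ρ)‖ ≤
          ε / ‖suzukiZeroParam (1 - conj ρ₀) - suzukiZeroParam ρ‖ ^ (1 + δ)) →
      ∀ S : ℂ, HasSum (fun ρ : ZetaZeros.riemannZetaNontrivialZeros ↦
          (riemannZetaZeroOrder (ρ : ℂ) : ℂ) *
            (c₁ (suzukiZeroParam ρ) - c₂ (suzukiZeroParam ρ)) *
            conj (c₁ (conj (suzukiZeroParam ρ)) - c₂ (conj (suzukiZeroParam ρ)))) S →
        S.re < 0 := by
  classical
  -- notation
  set γ₀ := suzukiZeroParam ρ₀ with hγ₀def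
  have hρ₁ : 1 - conj ρ₀ ∈ ZetaZeros.riemannZetaNontrivialZeros :=
    ZetaZeros.riemannZetaNontrivialZeros.one_sub_conj_mem hρ₀
  have hγ₁ : suzukiZeroParam (1 - conj ρ₀) = conj γ₀ := suzukiZeroParam_one_sub_conj ρ₀
  have hne : 1 - conj ρ₀ ≠ ρ₀ := one_sub_conj_ne_self hoff
  have him : γ₀.im ≠ 0 := by
    rw [hγ₀def, suzukiZeroParam_im]; exact sub_ne_zero.mpr hoff
  have hd : 0 < ‖γ₀ - conj γ₀‖ := by
    rw [norm_pos_iff, sub_ne_zero]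
    intro h
    have := congrArg Complex.im h
    rw [Complex.conj_im] at this
    exact him (by linarith)
  have hdp : 0 < ‖γ₀ - conj γ₀‖ ^ (1 + δ) := Real.rpow_pos_of_pos hd _
  -- the majorant constant
  have hBsum := summable_order_mul_sepWeight_sq γ₀ hδ.le
  set C : ℝ := ∑' ρ : ZetaZeros.riemannZetaNontrivialZeros,
    (riemannZetaZeroOrder (ρ : ℂ) : ℝ) * sepWeight γ₀ δ (suzukiZeroParam ρ) ^ 2 with hCdef
  have hm0 : ∀ ρ : ZetaZeros.riemannZetaNontrivialZeros, (0 : ℝ) ≤ riemannZetaZeroOrder (ρ : ℂ) :=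
    fun ρ ↦ by
      have h1 := ZetaZeros.riemannZetaNontrivialZeros.one_le_order ρ.2
      exact_mod_cast (show (0 : ℤ) ≤ _ by omega)
  have hg0 : ∀ ρ : ZetaZeros.riemannZetaNontrivialZeros,
      0 ≤ (riemannZetaZeroOrder (ρ : ℂ) : ℝ) * sepWeight γ₀ δ (suzukiZeroParam ρ) ^ 2 :=
    fun ρ ↦ mul_nonneg (hm0 ρ) (sq_nonneg _)
  have hC : 0 ≤ C := tsum_nonneg hg0
  -- choice of ε
  refine ⟨min 1 (min (‖γ₀ - conj γ₀‖ ^ (1 + δ) / 4) (1 / (4 * (C + 1)))), ?_, ?_⟩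
  · refine lt_min one_pos (lt_min (by positivity) (by positivity))
  intro c₁ c₂ h₁ h₂ hb₁ hb₂ S hS
  set ε := min 1 (min (‖γ₀ - conj γ₀‖ ^ (1 + δ) / 4) (1 / (4 * (C + 1)))) with hεdef
  have hε0 : 0 < ε := lt_min one_pos (lt_min (by positivity) (by positivity))
  have hε1 : ε ≤ 1 := min_le_left _ _
  have hεd : ε ≤ ‖γ₀ - conj γ₀‖ ^ (1 + δ) / 4 := (min_le_right _ _).trans (min_le_left _ _)
  have hεC : ε ≤ 1 / (4 * (C + 1)) := (min_le_right _ _).trans (min_le_right _ _)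
  -- the two small values a = c₂(γ₀), b = c₁(γ̄₀)
  have ha : ‖c₂ γ₀‖ ≤ 1 / 4 := by
    have h := hb₂ ρ₀ hρ₀ hne.symm
    rw [hγ₁, ← hγ₀def, norm_sub_rev] at h
    calc ‖c₂ γ₀‖ ≤ ε / ‖γ₀ - conj γ₀‖ ^ (1 + δ) := h
      _ ≤ (‖γ₀ - conj γ₀‖ ^ (1 + δ) / 4) / ‖γ₀ - conj γ₀‖ ^ (1 + δ) :=
          div_le_div_of_nonneg_right hεd hdp.le
      _ = 1 / 4 := by field_simp
  have hb : ‖c₁ (conj γ₀)‖ ≤ 1 / 4 := by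
    have h := hb₁ (1 - conj ρ₀) hρ₁ hne
    rw [hγ₁] at h
    calc ‖c₁ (conj γ₀)‖ ≤ ε / ‖γ₀ - conj γ₀‖ ^ (1 + δ) := h
      _ ≤ (‖γ₀ - conj γ₀‖ ^ (1 + δ) / 4) / ‖γ₀ - conj γ₀‖ ^ (1 + δ) :=
          div_le_div_of_nonneg_right hεd hdp.le
      _ = 1 / 4 := by field_simp
  -- the summand and the two distinguished indices
  set f : ZetaZeros.riemannZetaNontrivialZeros → ℂ := fun ρ ↦
    (riemannZetaZeroOrder (ρ : ℂ) : ℂ) * (c₁ (suzukiZeroParam ρ) - c₂ (suzukiZeroParam ρ)) *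
      conj (c₁ (conj (suzukiZeroParam ρ)) - c₂ (conj (suzukiZeroParam ρ))) with hfdef
  set z₀ : ZetaZeros.riemannZetaNontrivialZeros := ⟨ρ₀, hρ₀⟩ with hz₀
  set z₁ : ZetaZeros.riemannZetaNontrivialZeros := ⟨1 - conj ρ₀, hρ₁⟩ with hz₁
  have hz : z₀ ≠ z₁ := by
    intro h; exact hne.symm (congrArg Subtype.val h)
  -- main terms
  set u : ℂ := c₁ γ₀ - c₂ γ₀ with hu
  set v : ℂ := c₁ (conj γ₀) - c₂ (conj γ₀) with hv
  have huv : (u * conj v).re ≤ -(1 / 4) := by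
    have : u * conj v = (1 - c₂ γ₀) * (conj (c₁ (conj γ₀)) - 1) := by
      rw [hu, hv, h₁, h₂, map_sub, map_one]
    rw [this]
    exact re_main_term_le ha hb
  have hvu : (v * conj u).re = (u * conj v).re := by
    have : v * conj u = conj (u * conj v) := by rw [map_mul, Complex.conj_conj, mul_comm]
    rw [this, Complex.conj_re]
  have hre_int : ∀ (m : ℤ) (w : ℂ), ((m : ℂ) * w).re = (m : ℝ) * w.re := by
    intro m w
    rw [← Complex.ofReal_intCast, Complex.re_ofReal_mul]
  have hm1 : ∀ ρ : ZetaZeros.riemannZetaNontrivialZeros, (1 : ℝ) ≤ riemannZetaZeroOrder (ρ : ℂ) :=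
    fun ρ ↦ by exact_mod_cast ZetaZeros.riemannZetaNontrivialZeros.one_le_order ρ.2
  have hf0 : (f z₀).re ≤ -(1 / 4) := by
    have : f z₀ = (riemannZetaZeroOrder ρ₀ : ℂ) * (u * conj v) := by
      simp only [hfdef, hz₀, ← hγ₀def, hu, hv]; ring
    rw [this, hre_int]
    nlinarith [hm1 z₀, huv]
  have hf1 : (f z₁).re ≤ -(1 / 4) := by
    have : f z₁ = (riemannZetaZeroOrder (1 - conj ρ₀) : ℂ) * (v * conj u) := by
      simp only [hfdef, hz₁, hγ₁, Complex.conj_conj, hu, hv]; ring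
    rw [this, hre_int, hvu]
    nlinarith [hm1 z₁, huv]
  -- tail terms: ‖f ρ‖ ≤ ε² m B² off {z₀, z₁}
  have htail : ∀ ρ : ZetaZeros.riemannZetaNontrivialZeros, ρ ≠ z₀ → ρ ≠ z₁ →
      ‖f ρ‖ ≤ ε ^ 2 * ((riemannZetaZeroOrder (ρ : ℂ) : ℝ) *
        sepWeight γ₀ δ (suzukiZeroParam ρ) ^ 2) := by
    intro ρ hρ0 hρ1
    have hρ0' : (ρ : ℂ) ≠ ρ₀ := fun h ↦ hρ0 (Subtype.ext h)
    have hρ1' : (ρ : ℂ) ≠ 1 - conj ρ₀ := fun h ↦ hρ1 (Subtype.ext h)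
    -- reflected index
    have hρs : 1 - conj (ρ : ℂ) ∈ ZetaZeros.riemannZetaNontrivialZeros :=
      ZetaZeros.riemannZetaNontrivialZeros.one_sub_conj_mem ρ.2
    have hρs0 : 1 - conj (ρ : ℂ) ≠ ρ₀ := by
      intro h; apply hρ1'
      rw [← h]; simp
    have hρs1 : 1 - conj (ρ : ℂ) ≠ 1 - conj ρ₀ := by
      intro h; apply hρ0'
      have := congrArg (fun w ↦ conj (1 - w)) h
      simpa using this
    have hγs : suzukiZeroParam (1 - conj (ρ : ℂ)) = conj (suzukiZeroParam ρ) :=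
      suzukiZeroParam_one_sub_conj _
    -- the two factor bounds
    have hB : ‖c₁ (suzukiZeroParam ρ) - c₂ (suzukiZeroParam ρ)‖ ≤
        ε * sepWeight γ₀ δ (suzukiZeroParam ρ) := by
      have e1 := hb₁ ρ ρ.2 hρ0'
      have e2 := hb₂ ρ ρ.2 hρ1'
      rw [hγ₁] at e2
      calc ‖c₁ (suzukiZeroParam ρ) - c₂ (suzukiZeroParam ρ)‖
          ≤ ‖c₁ (suzukiZeroParam ρ)‖ + ‖c₂ (suzukiZeroParam ρ)‖ := norm_sub_le _ _
        _ ≤ ε / ‖γ₀ - suzukiZeroParam ρ‖ ^ (1 + δ) +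
            ε / ‖conj γ₀ - suzukiZeroParam ρ‖ ^ (1 + δ) := add_le_add e1 e2
        _ = ε * sepWeight γ₀ δ (suzukiZeroParam ρ) := by unfold sepWeight; ring
    have hB' : ‖c₁ (conj (suzukiZeroParam ρ)) - c₂ (conj (suzukiZeroParam ρ))‖ ≤
        ε * sepWeight γ₀ δ (suzukiZeroParam ρ) := by
      have e1 := hb₁ (1 - conj (ρ : ℂ)) hρs hρs0
      have e2 := hb₂ (1 - conj (ρ : ℂ)) hρs hρs1
      rw [hγs] at e1 e2
      rw [hγ₁] at e2
      rw [← sepWeight_conj]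
      calc ‖c₁ (conj (suzukiZeroParam ρ)) - c₂ (conj (suzukiZeroParam ρ))‖
          ≤ ‖c₁ (conj (suzukiZeroParam ρ))‖ + ‖c₂ (conj (suzukiZeroParam ρ))‖ := norm_sub_le _ _
        _ ≤ ε / ‖γ₀ - conj (suzukiZeroParam ρ)‖ ^ (1 + δ) +
            ε / ‖conj γ₀ - conj (suzukiZeroParam ρ)‖ ^ (1 + δ) := add_le_add e1 e2
        _ = ε * sepWeight γ₀ δ (conj (suzukiZeroParam ρ)) := by unfold sepWeight; ring
    have hBn := sepWeight_nonneg γ₀ δ (suzukiZeroParam ρ)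
    calc ‖f ρ‖ = (riemannZetaZeroOrder (ρ : ℂ) : ℝ) *
          (‖c₁ (suzukiZeroParam ρ) - c₂ (suzukiZeroParam ρ)‖ *
            ‖c₁ (conj (suzukiZeroParam ρ)) - c₂ (conj (suzukiZeroParam ρ))‖) := by
          simp only [hfdef, norm_mul, Complex.norm_conj, Complex.norm_intCast]
          rw [abs_of_nonneg (hm0 ρ)]
          ring
      _ ≤ (riemannZetaZeroOrder (ρ : ℂ) : ℝ) *
          ((ε * sepWeight γ₀ δ (suzukiZeroParam ρ)) * (ε * sepWeight γ₀ δ (suzukiZeroParam ρ))) :=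
          mul_le_mul_of_nonneg_left (mul_le_mul hB hB' (norm_nonneg _) (by positivity)) (hm0 ρ)
      _ = ε ^ 2 * ((riemannZetaZeroOrder (ρ : ℂ) : ℝ) * sepWeight γ₀ δ (suzukiZeroParam ρ) ^ 2) := by
          ring
  -- split the sum
  have hsumf : Summable f := hS.summable
  set s : Finset ZetaZeros.riemannZetaNontrivialZeros := {z₀, z₁} with hsdef
  have hsplit : (∑ x ∈ s, f x) + ∑' x : {x // x ∉ s}, f x = S := by
    rw [← hS.tsum_eq]
    exact hsumf.sum_add_tsum_subtype_compl s
  have hsum2 : ∑ x ∈ s, f x = f z₀ + f z₁ := Finset.sum_pair hz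
  -- bound the tail tsum
  have htail' : ∀ x : {x // x ∉ s}, ‖f x‖ ≤ ε ^ 2 * ((riemannZetaZeroOrder ((x : ZetaZeros.riemannZetaNontrivialZeros) : ℂ) : ℝ) *
        sepWeight γ₀ δ (suzukiZeroParam (x : ZetaZeros.riemannZetaNontrivialZeros)) ^ 2) := by
    intro x
    have hx := x.2
    simp only [hsdef, Finset.mem_insert, Finset.mem_singleton, not_or] at hx
    exact htail x hx.1 hx.2
  have hgs : Summable (fun x : {x // x ∉ s} ↦ ε ^ 2 *
      ((riemannZetaZeroOrder ((x : ZetaZeros.riemannZetaNontrivialZeros) : ℂ) : ℝ) *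
        sepWeight γ₀ δ (suzukiZeroParam (x : ZetaZeros.riemannZetaNontrivialZeros)) ^ 2)) :=
    (hBsum.subtype _).mul_left (ε ^ 2)
  have hnorm_sum : Summable (fun x : {x // x ∉ s} ↦ ‖f x‖) :=
    Summable.of_nonneg_of_le (fun _ ↦ norm_nonneg _) htail' hgs
  have hT : ‖∑' x : {x // x ∉ s}, f x‖ ≤ ε ^ 2 * C := by
    calc ‖∑' x : {x // x ∉ s}, f x‖ ≤ ∑' x : {x // x ∉ s}, ‖f x‖ := norm_tsum_le_tsum_norm hnorm_sum
      _ ≤ ∑' x : {x // x ∉ s}, ε ^ 2 *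
          ((riemannZetaZeroOrder ((x : ZetaZeros.riemannZetaNontrivialZeros) : ℂ) : ℝ) *
            sepWeight γ₀ δ (suzukiZeroParam (x : ZetaZeros.riemannZetaNontrivialZeros)) ^ 2) :=
          hnorm_sum.tsum_le_tsum htail' hgs
      _ = ε ^ 2 * ∑' x : {x // x ∉ s},
          ((riemannZetaZeroOrder ((x : ZetaZeros.riemannZetaNontrivialZeros) : ℂ) : ℝ) *
            sepWeight γ₀ δ (suzukiZeroParam (x : ZetaZeros.riemannZetaNontrivialZeros)) ^ 2) :=
          tsum_mul_left
      _ ≤ ε ^ 2 * C := by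
          refine mul_le_mul_of_nonneg_left ?_ (sq_nonneg _)
          exact Summable.tsum_subtype_le _ {x | x ∉ s} hg0 hBsum
  -- conclude
  have hε2C : ε ^ 2 * C ≤ 1 / 4 := by
    have hε2 : ε ^ 2 ≤ ε := by nlinarith
    have h1 : ε * C ≤ 1 / (4 * (C + 1)) * C := mul_le_mul_of_nonneg_right hεC hC
    have h2 : 1 / (4 * (C + 1)) * C ≤ 1 / 4 := by
      rw [div_mul_eq_mul_div, one_mul, div_le_div_iff₀ (by positivity) (by norm_num)]
      nlinarith
    nlinarith
  have hreT : (∑' x : {x // x ∉ s}, f x).re ≤ ε ^ 2 * C :=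
    (Complex.re_le_norm _).trans hT
  rw [← hsplit, hsum2, add_re, add_re]
  linarith

end Literature.NumberTheory.LFunctions.SuzukiWeilCriterion

end Part1

/-!
## Part 2 — port of `Summits/RiemannHypothesis/RiemannHypothesis/Theorems/DeBrangesChainDoor.lean` (2 declarations kept)

# The RH-FREE door of Suzuki's criterion: `(1) ∧ (2) on V(0) → RiemannHypothesis` (CJM Prop. 5.8 ⟸)

`chainDoorV0_proof : WeilNormIdentityOn (suzukiV 0) ∧ ZeroSeparationOn (suzukiV 0) → RiemannHypothesis` — the printed
sufficiency half of M. Suzuki, Canad. J. Math. (2025) Prop. 5.8 (= arXiv:2301.00421v1 Thm. 1.3; §3.4, p. 7 L129–149), the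
CHEAP direction, on Suzuki's space `V(0) = L²(0,∞) ∩ 𝖪L²(0,∞)` (`Literature/NumberTheory/LFunctions/SuzukiWeilHilbertSpaceDefs.lean`).
PROOF (as printed, with honest constants).  If RH failed, take an off-line non-trivial zero `ρ₀`
(`exists_offLine_of_not_riemannHypothesis`) and its reflection `1 − ρ̄₀ ≠ ρ₀` (`γ(1 − ρ̄₀) = γ̄₀`).  Condition (2) at `ρ₀`
and at `1 − ρ̄₀`, with the `ε` of D2 (`weilSum_re_neg_of_separation`, previous Part), gives `ψ₁, ψ₂ ∈ V(0)` with
`ψ̂₁(γ₀) = 1`, `ψ̂₂(γ̄₀) = 1` and separated values elsewhere; `ψ := ψ₁ − ψ₂ ∈ V(0)` (`sub_mem_suzukiV`) has the values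
`c₁ − c₂` at every zero (`hasHatValue_sub` — additivity is the ONLY property of the objects used; no isometry, no `𝖪² = id`,
no boundary-value theorem), so condition (1) makes the Weil sum of `c₁ − c₂` equal to `2‖ψ‖² ≥ 0`, while D2 makes its real
part negative.  An RH-FREE theorem ABOUT an RH-EQUIVALENT criterion: formalising this door fixes WHICH identity on Suzuki's
RH-free space would prove RH; nothing here bears on the truth of RH.  (The Summits-side conjecture-leaf abbreviations
`IsolatedV0 := (1) ∧ (2)` and `ChainDoorV0 := IsolatedV0 → RH` of the RiemannHypothesis tree are not re-homed; the door is
stated with them unfolded.)  Reference: [Suzuki2025WeilHilbertSpace, CJM Prop. 5.8 p. 17, proof of sufficiency; arXiv v1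
Thm. 1.3, §3.4 p. 7].
-/

section Part2

namespace Literature.NumberTheory.LFunctions.SuzukiWeilCriterion

open Literature.NumberTheory.LFunctions _root_.MeasureTheory _root_.Complex _root_.Filter _root_.Set
open scoped ComplexConjugate _root_.Topology

/-! ## D3 — dictionary: an off-line non-trivial zero under `¬RH`; the reflection `ρ ↦ 1 − ρ̄` -/

/-- If RH fails there is a non-trivial zero of `ζ` off the critical line (Mathlib's
`RiemannHypothesis` unfolded; the set of non-trivial zeros is `ZetaZeros.riemannZetaNontrivialZeros`). [cite: Suzuki2025WeilHilbertSpace, CJM Prop. 5.8 p. 17, proof of sufficiency (= arXiv v1 Thm. 1.3 ⟸, §3.4 p. 7 L129–149)] -/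
theorem exists_offLine_of_not_riemannHypothesis (h : ¬ _root_.RiemannHypothesis) :
    ∃ ρ ∈ ZetaZeros.riemannZetaNontrivialZeros, ρ.re ≠ 1 / 2 := by
  by_contra hcon
  push Not at hcon
  apply h
  intro s hs htriv _
  exact hcon s ⟨hs, fun ⟨k, hk⟩ ↦ htriv ⟨k, hk.symm⟩⟩

/-! ## The door -/

/-- **THE DOOR (RH-FREE; [Su25c] Thm. 1.3 ⟸ = CJM Prop. 5.8 ⟸, §3.4): `(1) ∧ (2) on V(0) → RiemannHypothesis`**
(the Summits-side conjecture-leaf abbreviations `IsolatedV0 := (1) ∧ (2)`, `ChainDoorV0 := IsolatedV0 → RH` unfolded).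
If RH failed, take an off-line zero `ρ₀`; condition (2) at `ρ₀` and at `1 − ρ̄₀` gives
`ψ₁, ψ₂ ∈ V(0)` with `ψ̂₁(γ₀) = 1`, `ψ̂₂(γ̄₀) = 1` and separated values elsewhere; `ψ := ψ₁ − ψ₂ ∈ V(0)`
(additivity of `𝖪`) has values `c₁ − c₂` at every zero (additivity of the evaluation), so condition
(1) makes the Weil sum of `c₁ − c₂` equal to `2‖ψ‖² ≥ 0`, while D2 makes its real part negative.
[cite: Suzuki2025WeilHilbertSpace, CJM Prop. 5.8 p. 17, proof of sufficiency (= arXiv v1 Thm. 1.3 ⟸, §3.4 p. 7 L129–149)] -/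
theorem chainDoorV0_proof :
    WeilNormIdentityOn (suzukiV 0) ∧ ZeroSeparationOn (suzukiV 0) → _root_.RiemannHypothesis := by
  classical
  rintro ⟨hC1, hC2⟩
  by_contra hRH
  obtain ⟨ρ₀, hρ₀, hoff⟩ := exists_offLine_of_not_riemannHypothesis hRH
  obtain ⟨δ, hδ, hsep⟩ := hC2
  obtain ⟨ε, hε, hneg⟩ := weilSum_re_neg_of_separation hρ₀ hoff hδ
  have hρ₁ : 1 - conj ρ₀ ∈ ZetaZeros.riemannZetaNontrivialZeros :=
    ZetaZeros.riemannZetaNontrivialZeros.one_sub_conj_mem hρ₀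
  have hne : 1 - conj ρ₀ ≠ ρ₀ := one_sub_conj_ne_self hoff
  obtain ⟨ψ₁, hψ₁V, hψ₁one, hψ₁bd⟩ := hsep ρ₀ hρ₀ ε hε
  obtain ⟨ψ₂, hψ₂V, hψ₂one, hψ₂bd⟩ := hsep (1 - conj ρ₀) hρ₁ ε hε
  choose! v₁ hv₁ hv₁b using hψ₁bd
  choose! v₂ hv₂ hv₂b using hψ₂bd
  -- total value assignments on `ℂ` (only their values on `Γ` matter)
  set c₁ : ℂ → ℂ := Function.update (fun z ↦ v₁ (1 / 2 - I * z)) (suzukiZeroParam ρ₀) 1 with hc₁def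
  set c₂ : ℂ → ℂ := Function.update (fun z ↦ v₂ (1 / 2 - I * z)) (suzukiZeroParam (1 - conj ρ₀)) 1
    with hc₂def
  have hc₁₀ : c₁ (suzukiZeroParam ρ₀) = 1 := by
    simp only [hc₁def, Function.update_self]
  have hc₂₀ : c₂ (suzukiZeroParam (1 - conj ρ₀)) = 1 := by
    simp only [hc₂def, Function.update_self]
  have hc₁ : ∀ ρ : ℂ, ρ ≠ ρ₀ → c₁ (suzukiZeroParam ρ) = v₁ ρ := by
    intro ρ h
    simp only [hc₁def, Function.update_of_ne (suzukiZeroParam_injective.ne h),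
      one_half_sub_I_mul_suzukiZeroParam]
  have hc₂ : ∀ ρ : ℂ, ρ ≠ 1 - conj ρ₀ → c₂ (suzukiZeroParam ρ) = v₂ ρ := by
    intro ρ h
    simp only [hc₂def, Function.update_of_ne (suzukiZeroParam_injective.ne h),
      one_half_sub_I_mul_suzukiZeroParam]
  -- `ψ := ψ₁ − ψ₂ ∈ V(0)` with values `c₁ − c₂`
  have hψV : ψ₁ - ψ₂ ∈ suzukiV 0 := sub_mem_suzukiV hψ₁V hψ₂V
  have hvals : ∀ ρ ∈ ZetaZeros.riemannZetaNontrivialZeros,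
      HasHatValue (ψ₁ - ψ₂) (suzukiZeroParam ρ)
        ((fun z ↦ c₁ z - c₂ z) (suzukiZeroParam ρ)) := by
    intro ρ hρ
    refine hasHatValue_sub ?_ ?_
    · by_cases h : ρ = ρ₀
      · rw [h, hc₁₀]; exact hψ₁one
      · rw [hc₁ ρ h]; exact hv₁ ρ hρ h
    · by_cases h : ρ = 1 - conj ρ₀
      · rw [h, hc₂₀]; exact hψ₂one
      · rw [hc₂ ρ h]; exact hv₂ ρ hρ h
  have hsum := hC1 (ψ₁ - ψ₂) hψV (fun z ↦ c₁ z - c₂ z) hvals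
  have hb1 : ∀ ρ ∈ ZetaZeros.riemannZetaNontrivialZeros, ρ ≠ ρ₀ →
      ‖c₁ (suzukiZeroParam ρ)‖ ≤ ε / ‖suzukiZeroParam ρ₀ - suzukiZeroParam ρ‖ ^ (1 + δ) := by
    intro ρ hρ h; rw [hc₁ ρ h]; exact hv₁b ρ hρ h
  have hb2 : ∀ ρ ∈ ZetaZeros.riemannZetaNontrivialZeros, ρ ≠ 1 - conj ρ₀ →
      ‖c₂ (suzukiZeroParam ρ)‖ ≤
        ε / ‖suzukiZeroParam (1 - conj ρ₀) - suzukiZeroParam ρ‖ ^ (1 + δ) := by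
    intro ρ hρ h; rw [hc₂ ρ h]; exact hv₂b ρ hρ h
  have h2 : c₂ (conj (suzukiZeroParam ρ₀)) = 1 := by
    rw [← suzukiZeroParam_one_sub_conj]; exact hc₂₀
  have hlt := hneg c₁ c₂ hc₁₀ h2 hb1 hb2 _ hsum
  rw [Complex.ofReal_re] at hlt
  nlinarith [norm_nonneg (ψ₁ - ψ₂)]

end Literature.NumberTheory.LFunctions.SuzukiWeilCriterion

end Part2

/-!
## Part 3 — port of `Summits/RiemannHypothesis/RiemannHypothesis/Theorems/DeBrangesChainConverse.lean` (1 declarations kept)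

# CJM Prop. 5.8 (`Suzuki2025_prop58 : RH ↔ (1) ∧ (2)`) modulo the norm identity

`suzuki2025_prop58_of_normIdentity` — Suzuki 2025 Prop. 5.8 (`RiemannHypothesis ↔ WeilNormIdentityOn (suzukiV 0) ∧
ZeroSeparationOn (suzukiV 0)`, the named fact `Literature.NumberTheory.LFunctions.Suzuki2025_prop58` of
`SuzukiWeilHilbertSpace.lean`) from ONE input, CJM Thm. 5.5 (1) (`Suzuki2025_thm55_normIdentity`: RH ⟹ `‖ψ‖² = ½⟨ψ,ψ⟩_W` on
`V(0)`): sufficiency is the door of the previous Part, necessity of (2) is the tree theorem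
`zeroSeparationOn_suzukiV_zero_of_riemannHypothesis` (`SuzukiWeilOrthogonalSetProofs.lean`: the orthogonal family `ψ_γ ∈ V(0)`
with its printed values, CJM Prop. 4.1 / (5.11)), necessity of (1) is the input.  The input is itself the tree theorem
`Suzuki2025_thm55_normIdentity_holds` (`SuzukiWeilKernelExpansionProofs.lean`: completeness of `{ψ_γ}` via the kernel
expansion from the Hadamard partial fraction of `ξ′/ξ`), which the last Part feeds in.  Reference:
[Suzuki2025WeilHilbertSpace, CJM Prop. 5.8 p. 17 (TeX l.1953–1999)].
-/

section Part3

namespace Literature.NumberTheory.LFunctions.SuzukiWeilCriterion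

open Literature.NumberTheory.LFunctions _root_.MeasureTheory _root_.Complex _root_.Filter _root_.Set
open scoped ComplexConjugate _root_.Topology

/-- **CJM Prop. 5.8 (`Suzuki2025_prop58 : RH ↔ (1) ∧ (2)`) modulo ONE fact**: sufficiency is the kernel
door, necessity of (2) is a kernel theorem, necessity of (1) is the named fact
`Suzuki2025_thm55_normIdentity`. [cite: Suzuki2025WeilHilbertSpace, CJM Prop. 5.8 p. 17 (TeX l.1953–1999)] -/
theorem suzuki2025_prop58_of_normIdentity (h55 : Suzuki2025_thm55_normIdentity) : Suzuki2025_prop58 :=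
  ⟨fun hRH ↦ ⟨h55 hRH, zeroSeparationOn_suzukiV_zero_of_riemannHypothesis hRH⟩,
    fun h ↦ chainDoorV0_proof h⟩

end Literature.NumberTheory.LFunctions.SuzukiWeilCriterion

end Part3

/-! ## Part 4 — the EXACT discharge `Suzuki2025_prop58_holds` -/

namespace Literature.NumberTheory.LFunctions

/-- **The named fact `Suzuki2025_prop58` HOLDS** (`SuzukiWeilHilbertSpace.lean`; M. Suzuki, Canad. J. Math. (2025) Prop. 5.8 =
arXiv:2301.00421v1 Thm. 1.3: `RH ↔ (1) ∧ (2)` on `V(0)`), hypothesis-free, EXACT-name discharge: necessity by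
`Suzuki2025_thm55_normIdentity_holds` (CJM Thm. 5.5 (1)) and `zeroSeparationOn_suzukiV_zero_of_riemannHypothesis` (the
orthogonal family `ψ_γ`), sufficiency by the RH-FREE door `SuzukiWeilCriterion.chainDoorV0_proof` (Weil-sign argument at an
off-line zero, §3.4).  Literature-side twin of the Summits-side
`Summit.RiemannHypothesis.RiemannHypothesis.Theorems.DeBrangesChain.Suzuki2025_prop58_holds`.  RH-EQUIVALENT statement PROVED AS
AN EQUIVALENCE; nothing here bears on the truth of RH.
[cite: Suzuki2025WeilHilbertSpace, CJM Prop. 5.8 p. 17 (TeX l.1953–1999; = arXiv v1 Thm. 1.3 p. 3, proof §3.4 p. 7)] -/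
theorem Suzuki2025_prop58_holds : Suzuki2025_prop58 :=
  SuzukiWeilCriterion.suzuki2025_prop58_of_normIdentity Suzuki2025_thm55_normIdentity_holds

end Literature.NumberTheory.LFunctions

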